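import Literature.NumberTheory.QuadraticFields.BinaryQuadraticFormsRoots
import Literature.NumberTheory.QuadraticFields.FundamentalDiscriminant
import Literature.NumberTheory.QuadraticFields.LenstraPomeranceKroneckerPrimes
import Literature.NumberTheory.QuadraticFields.SquareRootsModuloTwoPower
import HarnessLib

/-!
# Gauss's count of representations: `r_n(−d) = #{b (mod 2n) : b² ≡ −d (mod 4n)}`
# (Oesterlé 1988, II §1, Théorème; Gauss, D.A. arts. 167, 168, 180)

Topic `NumberTheory/QuadraticFields`, namespace `Literature.NumberTheory.QuadraticFields.Quadratic.BinQF`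
(continuing `BinaryQuadraticFormsRoots.lean`, whose weighted identity
`sum_qroots_eq_sum_repForms` — roots of `M² + bM + e ≡ 0 (mod E)` versus proper representations
of `E` by the representatives `repForms (b² − 4e)`, each class weighted by `1/#Aut⁺` — is the
engine). Everything here is PROVED (theorems only; no definitions, no named facts).

J. Oesterlé, *Le problème de Gauss sur le nombre de classes*, Enseign. Math. (2) 34 (1988) 43–67,
II §1, pp. 53–54 (read from the page image `HOME/goldfeld/lit-scans/oesterle1988-p54.jpg`):

> (p. 53) «Les formes quadratiques de discriminant −3 et −4 ont des automorphismes distincts de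
> ±1 dans SL₂(Z). Pour éviter les complications techniques qui en résultent, nous supposerons dans
> la suite d ≠ 3 et d ≠ 4 … Soit q une forme quadratique de discriminant −d … Le nombre de
> représentations primitives d'un entier n ≥ 1 par q, comptées au signe près, est
> (12) r_n(q) = ½ Card{(u, v) ∈ Z² | q(u, v) = n et pgcd(u, v) = 1} … (14) r_n(−d) = Σ_{C ∈ Cl(−d)} r_n(C).»
> (p. 54) «THÉORÈME. Pour tout entier n ≥ 1, r_n(−d) est le nombre de b (mod. 2n) tels que
> b² ≡ −d (mod. 4n). La démonstration de Gauss est très élégante: Soit (q_i) un système de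
> représentants des classes de formes quadratiques de discriminant −d. Si b est un entier tel que b²
> s'écrive −d + 4nc, la forme quadratique nx² + bxy + cy² a pour discriminant −d et s'écrit
> q_i(ux + wy, vx + ty) pour un unique indice i et une certaine matrice (u w / v t) ∈ SL₂(Z). On a
> q_i(u, v) = n, et (u, v) est déterminé au signe près par b (mod. 2n) car I et −I sont les seuls
> automorphismes de q_i dans SL₂(Z). Inversement, chaque représentation primitive de n par l'une des
> formes q_i s'obtient par ce procédé à partir d'un unique b (mod. 2n) tel que b² ≡ −d (mod. 4n).»

Here `−d` is the discriminant of an imaginary quadratic field (Oesterlé's setting, II §2 (23):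
`Cl(−d)` = classes of forms of discriminant `−d`, all primitive), i.e. a negative FUNDAMENTAL
discriminant, and `d > 4`.  The system of representatives is the tree's `repForms (−d)` (for
fundamental `−d` these are exactly the reduced primitive forms, `isPosPrim_and_isReduced_of_mem_repForms`),
the proper representations are `reps R n`, and the «b (mod 2n)» are counted as `0 ≤ b < 2n`.

* `negOne_mem_autSet`, `mem_autSet_iff_of_isReduced`, `autSet_card_eq_two` — **«I et −I sont les
  seuls automorphismes»**: a reduced primitive positive definite form of discriminant `< −4` has
  exactly the two proper automorphs `±I` (case analysis on `eval_eq_a_cases`: the first column of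
  an automorph represents `a`);
* `isPosPrim_and_isReduced_of_mem_repForms` — for a negative fundamental discriminant every member
  of `repForms` is a reduced PRIMITIVE form (no imprimitive classes: `g² ∣ −d ⇒ g² ∈ {1, 4}`, and
  `g = 2` would need a form of discriminant `−d/4 ≡ 2, 3 (mod 4)`);
* `card_sqrtsMod_eq_card_qroots` — `#{0 ≤ b < 2n : 4n ∣ b² + d} = #{0 ≤ M < n : n ∣ M² + βM + e}`
  for `−d = β² − 4e`, `β ∈ {0, 1}` (`b = 2M + β`);
* `two_mul_card_sqrtsMod_eq_sum_card_reps` — **the THÉORÈME as printed**, in the form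
  `2 · #{b (mod 2n) : b² ≡ −d (mod 4n)} = Σ_{q_i} #{(u, v) coprime : q_i(u, v) = n}`, i.e.
  `#{b (mod 2n) : …} = Σ_i r_n(q_i) = r_n(−d)` with Oesterlé's `r_n(q) = ½ #{…}` ((12), (14)).

* `card_repForms_eq_classNumber` — for a negative fundamental discriminant the number of classes
  `#repForms(−d)` is the form class number `h(−d)` (`BinQF.classNumber`);
* `encadrement_classNumber` — **Oesterlé's (15)** (p. 54, «On déduit de (13) un encadrement du
  nombre de classes»): `Σ_{n ≤ √d/2} r_n(−d) ≤ h(−d) ≤ Σ_{n ≤ √(d/3)} r_n(−d)`, in the form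
  `Σ_{1 ≤ n ≤ ⌊√d⌋/2} Σ_i #reps(q_i, n) ≤ 2 h(−d) ≤ Σ_{1 ≤ n ≤ ⌊√(d/3)⌋} Σ_i #reps(q_i, n)` (each reduced
  class represents its `a ≤ √(d/3)` by `(±1, 0)`, and below `c > √d/2` it properly represents only
  `a`, once up to sign: p. 53 «On a r_a(C) ≠ 0, et si n ≥ 1 est un entier < c tel que r_n(C) ≠ 0, on a
  nécessairement n = a et r_n(C) = 1») (appended 2026-08-22, same seat).

* **The COROLLAIRE** (p. 54, appended 2026-08-22): «En décomposant Z/4nZ en ses composantes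
  primaires, on obtient la forme équivalente suivante de l'énoncé précédent: COROLLAIRE. Pour que
  r_n(−d) ≠ 0, il faut et il suffit que n soit de la forme d′p₁^{α₁} … p_m^{α_m}, avec d′ un diviseur
  de d sans facteurs carrés, p₁, …, p_m des nombres premiers deux à deux distincts modulo lesquels −d
  est un carré non nul, et α₁, …, α_m des entiers ≥ 1. On a alors r_n(−d) = 2^m.» Typed with the
  tree's set `𝒫_{−d} = kroneckerOnePrimes (−d)` of primes `p` with Kronecker symbol `(−d/p) = 1`
  (`LenstraPomeranceKroneckerPrimes.lean`: `p ∤ d` and `−d` a square modulo `4p`) for «premiers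
  modulo lesquels −d est un carré non nul»: for odd `p` this is literally the printed condition
  (`mem_kroneckerOnePrimes_iff_of_ne_two`), for `p = 2` it reads `−d ≡ 1 (mod 8)`
  (`two_mem_kroneckerOnePrimes_iff`), which is what the decomposition of `Z/4nZ` into primary
  components gives (the 2-primary component of `Z/4nZ` is `Z/2^{k+2}Z`, not `Z/2Z`; read literally
  «modulo 2» the printed condition would hold for every odd `d`, but e.g. `r_2(−11) = 0`):
  `sum_card_reps_ne_zero_iff` (`r_n(−d) ≠ 0 ⟺ n = d′m`, `d′` squarefree dividing `d`, all prime
  factors of `m` in `𝒫_{−d}`) and `sum_card_reps_eq_two_pow` (`r_{d′m}(−d) = 2^{ω(m)}`, as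
  `Σ_i #reps(q_i, d′m) = 2^{ω(m)+1}`), for `d > 4`; and for the count of the `b (mod 2n)` itself
  `card_sqrtsMod_ne_zero_iff` (every negative fundamental `−d`) and `card_sqrtsMod_eq_two_pow` (every
  `−d ≡ 0, 1 (mod 4)`). The proof is the printed one: the number `ρ(n)` of roots of
  `M² + βM + e ≡ 0 (mod n)` (`−d = β² − 4e`, `b = 2M + β`) is multiplicative in `n` by the Chinese
  remainder theorem (`card_qroots_mul`), and at a prime power `p^k` (`k ≥ 1`) it is `2` if
  `p ∈ 𝒫_{−d}` (`card_qroots_prime_pow_eq_two`, `qroots_prime_pow_nonempty` — Hensel, from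
  `SquareRootsModulo*.lean`), `1` if `p ∣ d` and `k = 1` (`card_qroots_prime_eq_one`), and `0`
  otherwise (`qroots_prime_pow_eq_empty_of_dvd` for `p ∣ d`, `k ≥ 2`, using that `−d` is
  fundamental; `qroots_prime_pow_eq_empty_of_not_mem` for inert `p`).

## References

* [Oesterle1988Gauss] J. Oesterlé, Enseign. Math. (2) 34 (1988), II §1, (12)–(14) p. 53, the
  Théorème p. 54 (with Gauss's proof), the encadrement (15) p. 54 and the Corollaire p. 54.
* [LenstraPomerance1992] H. W. Lenstra Jr., C. Pomerance, J. Amer. Math. Soc. 5 (1992), §2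
  (2.6)–(2.7) (the Kronecker symbol at a prime and the set `𝒫_Δ`).
* C. F. Gauss, *Disquisitiones Arithmeticae*, arts. 167, 168, 180 (cited by Oesterlé, p. 54 n. 1).
* [Cox2013] D. A. Cox, *Primes of the form x² + ny²*, §2.A Lemma 2.3, Thm. 2.8.
-/

namespace Literature.NumberTheory.QuadraticFields.Quadratic

namespace BinQF

open Finset

/-! ### «I et −I sont les seuls automorphismes de q_i dans SL₂(Z)» -/

/-- `−I` is a proper automorph of every positive definite form. [folklore] -/
private theorem negOne_mem_autSet (f : BinQF) (ha : 0 < f.a) (hD : f.disc < 0) :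
    (⟨-1, 0, 0, -1⟩ : Mat2) ∈ f.autSet := by
  rw [f.mem_autSet ha hD]
  refine ⟨by simp [Mat2.det], ?_⟩
  simp only [actM]
  ext <;> simp [act]

/-- A primitive form `(a, b, a)` with `b = 0` or `|b| = a` has `a = 1` (for `a > 0`). [folklore] -/
private theorem a_eq_one_of_isPrimitive_of_dvd {f : BinQF} (hf : f.IsPrimitive) (ha : 0 < f.a)
    (hb : f.a ∣ f.b) (hc : f.c = f.a) : f.a = 1 := by
  have hu := (isPrimitive_iff f).mp hf f.a dvd_rfl hb (hc ▸ dvd_rfl)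
  rcases Int.isUnit_iff.mp hu with h | h
  · exact h
  · linarith

/-- **The proper automorphs of a reduced primitive form of discriminant `D < −4` are `±I`.** If
`f·m = f` with `det m = 1`, the first column `(p, r)` of `m` represents `a`, so by Legendre's
observation (`eval_eq_a_cases`) either `(p, r) = ±(1, 0)` — and then `m = ±I` — or `f` is one of the
boundary forms `(a, 0, a)`, `(a, ±a, a)`, which are primitive only for `a = 1`, i.e. `D ∈ {−4, −3}`.
Oesterlé p. 53: «Les formes quadratiques de discriminant −3 et −4 ont des automorphismes distincts
de ±1 dans SL₂(Z)» (and only those). [cite: Oesterle1988Gauss, II §1 p. 53–54] -/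
theorem mem_autSet_iff_of_isReduced {f : BinQF} {D : ℤ} (hf : f.IsPosPrim D) (hr : f.IsReduced)
    (hD4 : D < -4) {m : Mat2} :
    m ∈ f.autSet ↔ m = Mat2.one ∨ m = ⟨-1, 0, 0, -1⟩ := by
  have hdisc : f.disc = D := hf.disc_eq
  have hD : f.disc < 0 := by rw [hdisc]; omega
  have ha := hf.a_pos
  constructor
  · intro hm
    rw [f.mem_autSet ha hD] at hm
    obtain ⟨hdet, hact⟩ := hm
    have hpr : f.eval m.p m.r = f.a := by rw [← a_actM, hact]
    have hb' : 2 * f.a * m.p * m.q + f.b * (m.p * m.s + m.q * m.r) + 2 * f.c * m.r * m.s = f.b := by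
      have h := congrArg BinQF.b hact
      simp only [actM, act] at h
      exact h
    simp only [Mat2.det] at hdet
    have hpr0 : m.p ≠ 0 ∨ m.r ≠ 0 := by
      by_contra h
      push Not at h
      rw [h.1, h.2] at hdet
      simp at hdet
    have hba : |f.b| ≤ f.a := hr.1
    rcases eval_eq_a_cases hr ha hpr0 hpr with ⟨hr0, hp⟩ | ⟨hp0, hr1, hca⟩ | ⟨hp0, hr0, hbabs, hca⟩
    · -- `r = 0`, `p = ±1`: then `s = p` and `2apq = 0` forces `q = 0`
      rw [hr0] at hdet hb'
      rcases hp with hp | hp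
      · rw [hp] at hdet hb'
        have hs : m.s = 1 := by linarith
        rw [hs] at hb'
        have hq : m.q = 0 := by nlinarith
        left
        ext <;> simp [Mat2.one, hp, hq, hr0, hs]
      · rw [hp] at hdet hb'
        have hs : m.s = -1 := by linarith
        rw [hs] at hb'
        have hq : m.q = 0 := by nlinarith
        right
        ext <;> simp [hp, hq, hr0, hs]
    · -- `p = 0`, `r = ±1`, `c = a`: then `q = -r` and `b = ±a·s`, a boundary form of disc `−4` or `−3`
      exfalso
      have hb0 : 0 ≤ f.b := hr.2.2 (Or.inr hca.symm)
      rw [hp0] at hdet hb'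
      -- `b = a * (r * s)` in both sign cases
      have hbs : f.b = f.a * (m.r * m.s) := by
        rcases hr1 with hr1 | hr1
        · rw [hr1] at hdet hb'
          have hq : m.q = -1 := by linarith
          rw [hq, hca] at hb'
          rw [hr1]; linarith
        · rw [hr1] at hdet hb'
          have hq : m.q = 1 := by linarith
          rw [hq, hca] at hb'
          rw [hr1]; linarith
      set t : ℤ := m.r * m.s with ht
      -- `0 ≤ a t = b ≤ a` ⇒ `t ∈ {0, 1}`
      have ht0 : 0 ≤ t := by
        by_contra h
        push Not at h
        have : f.a * t ≤ f.a * (-1) := by nlinarith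
        linarith
      have ht1 : t ≤ 1 := by
        by_contra h
        push Not at h
        have : f.a * 2 ≤ f.a * t := by nlinarith
        have hle : f.b ≤ f.a := (le_abs_self _).trans hba
        linarith
      have ha1 : f.a = 1 := by
        refine a_eq_one_of_isPrimitive_of_dvd hf.primitive ha ⟨t, hbs⟩ hca
      -- the discriminant is then `b² − 4 = −4` or `−3`
      have hbval : f.b = t := by rw [hbs, ha1, one_mul]
      have hdisc' : D = t ^ 2 - 4 := by
        rw [← hdisc, disc, hbval, hca, ha1]; ring
      interval_cases t <;> omega
    · -- `pr ≠ 0`, `|b| = a = c`: the form `(1, 1, 1)` of discriminant `−3`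
      exfalso
      have hb0 : 0 ≤ f.b := hr.2.2 (Or.inl hbabs)
      have hbeq : f.b = f.a := by rw [← hbabs, abs_of_nonneg hb0]
      have ha1 : f.a = 1 := a_eq_one_of_isPrimitive_of_eq hf.primitive ha hbeq hca
      have hdisc' : D = -3 := by
        rw [← hdisc, disc, hbeq, hca, ha1]; ring
      omega
  · rintro (rfl | rfl)
    · exact f.one_mem_autSet ha hD
    · exact f.negOne_mem_autSet ha hD

/-- **`#Aut⁺(f) = 2`** for a reduced primitive positive definite form of discriminant `D < −4`
(the value «±1» that divides Oesterlé's count (12) «comptées au signe près»).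
[cite: Oesterle1988Gauss, II §1 p. 53–54] -/
theorem autSet_card_eq_two {f : BinQF} {D : ℤ} (hf : f.IsPosPrim D) (hr : f.IsReduced)
    (hD4 : D < -4) : f.autSet.card = 2 := by
  have hset : f.autSet = {Mat2.one, ⟨-1, 0, 0, -1⟩} := by
    ext m
    rw [mem_autSet_iff_of_isReduced hf hr hD4, mem_insert, mem_singleton]
  rw [hset, card_insert_of_notMem (by simp [Mat2.one, Mat2.ext_iff]), card_singleton]

/-! ### For a fundamental discriminant every class is primitive -/

/-- **No imprimitive classes for a fundamental discriminant.** If `−d` is a negative fundamental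
discriminant (`−d ≡ 1 (mod 4)` square-free, or `−d = 4k`, `k ≡ 2, 3 (mod 4)` square-free), every
member of the system of representatives `repForms (−d)` of ALL classes of positive definite forms of
discriminant `−d` is a reduced primitive form of discriminant `−d` (a class `g·S` with `g ≥ 2`
would need `g² ∣ d`, hence `g = 2`, and a form `S` of discriminant `−d/4 ≡ 2, 3 (mod 4)`).
This is why Oesterlé's `Cl(−d)` (II §2, ideal classes of `ℚ(i√d)`) is the set of all form classes.
[cite: Oesterle1988Gauss, II §1 p. 53–54 and §2 (23)] -/
theorem isPosPrim_and_isReduced_of_mem_repForms {d : ℕ}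
    (hfd : ((-(d : ℤ)) % 4 = 1 ∧ Squarefree (-(d : ℤ)) ∧ (-(d : ℤ)) ≠ 1) ∨
      (4 ∣ (-(d : ℤ)) ∧ ((-(d : ℤ)) / 4 % 4 = 2 ∨ (-(d : ℤ)) / 4 % 4 = 3) ∧
        Squarefree ((-(d : ℤ)) / 4)))
    (hd0 : 0 < d) {R : BinQF} (hR : R ∈ repForms (-(d : ℤ))) :
    R.IsPosPrim (-(d : ℤ)) ∧ R.IsReduced := by
  have hΔ : (-(d : ℤ)) < 0 := by omega
  obtain ⟨g, hg1, hdvd, S, hS, rfl⟩ := (mem_repForms hΔ.ne).1 hR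
  have hDS := div_sq_neg hΔ hg1 hdvd
  obtain ⟨hpp, hred⟩ := (S.mem_reducedFormsList_iff hDS).1 hS
  rcases sq_eq_one_or_four_of_sq_dvd hfd hdvd with h1 | h4
  · -- `g = 1`
    have hg : (g : ℤ) = 1 := by
      have hg0 : (0 : ℤ) ≤ g := by positivity
      nlinarith
    have hscale : scale (g : ℤ) S = S := by
      rw [hg]; ext <;> simp [scale]
    rw [hscale]
    rw [hg, one_pow, Int.ediv_one] at hpp
    exact ⟨hpp, hred⟩
  · -- `g = 2` is impossible: `S` would have discriminant `−d/4 ≡ 2, 3 (mod 4)`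
    exfalso
    rw [h4] at hpp hdvd
    have h4' := hpp.emod_four
    rcases hfd with ⟨h1, -, -⟩ | ⟨-, h23, -⟩
    · omega
    · omega

/-! ### «b (mod 2n) tels que b² ≡ −d (mod 4n)» versus the roots of a monic congruence -/

/-- **`#{0 ≤ b < 2n : 4n ∣ b² + d} = #{0 ≤ M < n : n ∣ M² + βM + e}`** when `−d = β² − 4e` with
`β ∈ {0, 1}`: the substitution `b = 2M + β` (`b² + d = 4(M² + βM + e)`, and `b ≡ β (mod 2)` is forced
by `b² ≡ −d ≡ β² (mod 4)`). [folklore] -/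
private theorem card_sqrtsMod_eq_card_qroots {d β : ℕ} {e : ℤ} (hβ : β = 0 ∨ β = 1)
    (hde : ((β : ℕ) : ℤ) ^ 2 - 4 * e = -(d : ℤ)) (n : ℕ) :
    ((range (2 * n)).filter (fun b : ℕ => (4 * (n : ℤ)) ∣ (b : ℤ) ^ 2 + d)).card =
      (qroots (β : ℤ) e n).card := by
  -- parity: every `b` in the set has `b % 2 = β`
  have hpar : ∀ b : ℕ, (4 * (n : ℤ)) ∣ (b : ℤ) ^ 2 + d → b % 2 = β := by
    rintro b ⟨k, hk⟩
    have h4 : (4 : ℤ) ∣ (b : ℤ) ^ 2 + d := ⟨n * k, by rw [hk]; ring⟩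
    rcases Nat.even_or_odd b with ⟨t, ht⟩ | ⟨t, ht⟩
    · have hb : (b : ℤ) ^ 2 + d = 4 * ((t : ℤ) ^ 2) + d := by rw [ht]; push_cast; ring
      rw [hb] at h4
      have hd : (4 : ℤ) ∣ (d : ℤ) := (dvd_add_right (dvd_mul_right 4 ((t : ℤ) ^ 2))).mp h4
      rcases hβ with rfl | rfl
      · omega
      · exfalso; push_cast at hde; omega
    · have hb : (b : ℤ) ^ 2 + d = 4 * ((t : ℤ) ^ 2 + t) + (1 + d) := by rw [ht]; push_cast; ring
      rw [hb] at h4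
      have hd : (4 : ℤ) ∣ 1 + (d : ℤ) := (dvd_add_right (dvd_mul_right 4 ((t : ℤ) ^ 2 + t))).mp h4
      rcases hβ with rfl | rfl
      · exfalso; push_cast at hde; omega
      · omega
  refine card_bij' (fun b _ => b / 2) (fun M _ => 2 * M + β) ?_ ?_ ?_ ?_
  · -- `b ↦ (b − β)/2 = b/2` lands in the roots
    intro b hb
    rw [mem_filter, mem_range] at hb
    obtain ⟨hb2n, hdiv⟩ := hb
    have hb' : (b : ℤ) = 2 * ((b / 2 : ℕ) : ℤ) + (β : ℕ) := by
      have := hpar b hdiv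
      rcases hβ with rfl | rfl <;> push_cast <;> omega
    rw [mem_qroots]
    refine ⟨by omega, ?_⟩
    obtain ⟨k, hk⟩ := hdiv
    refine ⟨k, Int.eq_of_mul_eq_mul_left (by norm_num : (4 : ℤ) ≠ 0) ?_⟩
    rw [hb'] at hk
    linear_combination hk - hde
  · -- `M ↦ 2M + β` lands in the square roots mod `4n`
    intro M hM
    rw [mem_qroots] at hM
    obtain ⟨hMn, k, hk⟩ := hM
    rw [mem_filter, mem_range]
    refine ⟨by rcases hβ with rfl | rfl <;> omega, k, ?_⟩
    push_cast
    linear_combination 4 * hk + hde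
  · -- left inverse
    intro b hb
    rw [mem_filter] at hb
    have := hpar b hb.2
    rcases hβ with rfl | rfl <;> omega
  · -- right inverse
    intro M _
    rcases hβ with rfl | rfl <;> omega

/-! ### The theorem -/

/-- **Gauss's theorem as stated by Oesterlé (1988, II §1, p. 54): `r_n(−d)` is the number of
`b (mod 2n)` with `b² ≡ −d (mod 4n)`.** For a negative fundamental discriminant `−d` with `d > 4`
(«d ≠ 3, 4») and `n ≥ 1`:
`2 · #{0 ≤ b < 2n : 4n ∣ b² + d} = Σ_{q_i ∈ repForms(−d)} #{(u, v) : gcd(u, v) = 1, q_i(u, v) = n}`,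
i.e. `#{b (mod 2n) : b² ≡ −d (mod 4n)} = Σ_i r_n(q_i) = r_n(−d)` with Oesterlé's
`r_n(q) = ½ Card{(u, v) ∈ Z² | q(u, v) = n, pgcd(u, v) = 1}` ((12), «comptées au signe près»)
and `r_n(−d) = Σ_{C ∈ Cl(−d)} r_n(C)` ((14); the `q_i` = the reduced primitive forms of discriminant
`−d`, one per class). Proof as printed, through the tree's weighted root/representation identity
`sum_qroots_eq_sum_repForms` (`b ↦` the form `(n, b, c)` `↦` its representative `q_i` and the first
column `±(u, v)` of the transition matrix) and «I et −I sont les seuls automorphismes»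
(`autSet_card_eq_two`). [cite: Oesterle1988Gauss, II §1 Théorème p. 54] -/
theorem two_mul_card_sqrtsMod_eq_sum_card_reps {d : ℕ} (hd4 : 4 < d)
    (hfd : ((-(d : ℤ)) % 4 = 1 ∧ Squarefree (-(d : ℤ)) ∧ (-(d : ℤ)) ≠ 1) ∨
      (4 ∣ (-(d : ℤ)) ∧ ((-(d : ℤ)) / 4 % 4 = 2 ∨ (-(d : ℤ)) / 4 % 4 = 3) ∧
        Squarefree ((-(d : ℤ)) / 4)))
    {n : ℕ} (hn : 0 < n) :
    2 * ((range (2 * n)).filter (fun b : ℕ => (4 * (n : ℤ)) ∣ (b : ℤ) ^ 2 + d)).card =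
      ∑ R ∈ repForms (-(d : ℤ)), (reps R n).card := by
  -- write `−d = β² − 4e` with `β ∈ {0, 1}`
  obtain ⟨β, e, hβ, hde⟩ :
      ∃ (β : ℕ) (e : ℤ), (β = 0 ∨ β = 1) ∧ ((β : ℕ) : ℤ) ^ 2 - 4 * e = -(d : ℤ) := by
    rcases hfd with ⟨h1, -, -⟩ | ⟨h4, -, -⟩
    · exact ⟨1, ((d : ℤ) + 1) / 4, Or.inr rfl, by push_cast; omega⟩
    · exact ⟨0, (d : ℤ) / 4, Or.inl rfl, by push_cast; omega⟩
  have hΔ : ((β : ℕ) : ℤ) ^ 2 - 4 * e < 0 := by rw [hde]; omega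
  -- the weighted identity with `g ≡ 1`
  have key := sum_qroots_eq_sum_repForms (K := ℚ) hΔ hn (fun _ => (1 : ℚ))
  rw [hde] at key
  simp only [sum_const, nsmul_eq_mul, mul_one] at key
  -- every class is reduced primitive of discriminant `−d < −4`, so `#Aut⁺ = 2`
  have haut : ∀ R ∈ repForms (-(d : ℤ)), (R.autSet.card : ℚ)⁻¹ * ((reps R n).card : ℚ) =
      (1 / 2 : ℚ) * ((reps R n).card : ℚ) := by
    intro R hR
    obtain ⟨hpp, hred⟩ := isPosPrim_and_isReduced_of_mem_repForms hfd (by omega) hR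
    rw [autSet_card_eq_two hpp hred (by omega)]
    norm_num
  rw [sum_congr rfl haut, ← mul_sum] at key
  rw [card_sqrtsMod_eq_card_qroots hβ hde n]
  have h2 : (2 : ℚ) * ((qroots ((β : ℕ) : ℤ) e n).card : ℚ) =
      ((∑ R ∈ repForms (-(d : ℤ)), (reps R n).card : ℕ) : ℚ) := by
    rw [key]; push_cast; ring
  exact_mod_cast h2

/-! ### The encadrement (15): `Σ_{n ≤ √d/2} r_n(−d) ≤ h(−d) ≤ Σ_{n ≤ √(d/3)} r_n(−d)` -/

/-- **`#repForms(−d) = h(−d)`** for a negative fundamental discriminant: the system of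
representatives of all classes of forms of discriminant `−d` is the set of reduced primitive forms,
whose number is the form class number (`classNumber`, Cox Thm. 2.13).
[cite: Oesterle1988Gauss, II §1 (13)–(14) p. 53] -/
theorem card_repForms_eq_classNumber {d : ℕ}
    (hfd : ((-(d : ℤ)) % 4 = 1 ∧ Squarefree (-(d : ℤ)) ∧ (-(d : ℤ)) ≠ 1) ∨
      (4 ∣ (-(d : ℤ)) ∧ ((-(d : ℤ)) / 4 % 4 = 2 ∨ (-(d : ℤ)) / 4 % 4 = 3) ∧
        Squarefree ((-(d : ℤ)) / 4)))
    (hd0 : 0 < d) : (repForms (-(d : ℤ))).card = classNumber (-(d : ℤ)) := by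
  rw [classNumber_eq_card]
  congr 1
  ext R
  rw [List.mem_toFinset]
  constructor
  · intro hR
    obtain ⟨hpp, hred⟩ := isPosPrim_and_isReduced_of_mem_repForms hfd hd0 hR
    exact (R.mem_reducedFormsList_iff (by omega)).2 ⟨hpp, hred⟩
  · intro hR
    rw [mem_repForms (by omega)]
    refine ⟨1, le_rfl, by simp, R, ?_, ?_⟩
    · rw [Nat.cast_one, one_pow, Int.ediv_one]; exact hR
    · ext <;> simp [scale]

/-- The proper representations of an integer `n < c` by a reduced form `(a, b, c)` (`a > 0`)
are among `(±1, 0)` — off the axes `f ≥ a − |b| + c ≥ c`, on the `y`-axis `f = c y² ≥ c`; so below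
`c` a reduced class properly represents only `a`, once up to sign (Oesterlé p. 53: «si n ≥ 1 est un
entier < c tel que r_n(C) ≠ 0, on a nécessairement n = a et r_n(C) = 1»).
[cite: Oesterle1988Gauss, II §1 p. 53] -/
theorem reps_subset_of_lt_c {R : BinQF} (hr : R.IsReduced) (ha : 0 < R.a) (hD : R.disc < 0)
    {n : ℕ} (hn : (n : ℤ) < R.c) : reps R n ⊆ {((1 : ℤ), (0 : ℤ)), (-1, 0)} := by
  intro v hv
  rw [mem_reps ha hD] at hv
  obtain ⟨hval, hg⟩ := hv
  rw [mem_insert, mem_singleton]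
  by_cases h2 : v.2 = 0
  · have h1 : v.1.natAbs = 1 := by
      have := hg
      rw [h2, Int.gcd_zero_right] at this
      exact this
    have h1' : v.1 = 1 ∨ v.1 = -1 := by omega
    rcases h1' with h | h
    · left; exact Prod.ext h h2
    · right; exact Prod.ext h h2
  · exfalso
    by_cases h1 : v.1 = 0
    · -- `v = (0, ±1)`, value `c`
      have hv2 : v.2.natAbs = 1 := by
        have := hg
        rw [h1, Int.gcd_zero_left] at this
        exact this
      have hsq : v.2 ^ 2 = 1 := by
        have : v.2 = 1 ∨ v.2 = -1 := by omega
        rcases this with h | h <;> rw [h] <;> norm_num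
      have : R.eval v.1 v.2 = R.c := by simp only [eval, h1, hsq]; ring
      rw [this] at hval
      omega
    · have hle := sub_abs_add_le_eval_of_isReduced hr h1 h2
      rw [hval] at hle
      have hba : |R.b| ≤ R.a := hr.1
      omega

/-- **Oesterlé 1988, II §1 (15): `Σ_{n ≤ √d/2} r_n(−d) ≤ h(−d) ≤ Σ_{n ≤ √(d/3)} r_n(−d)`** for a
negative fundamental discriminant `−d`, `d > 4` — here with `2 r_n(−d) = Σ_i #reps(q_i, n)`
(`q_i ∈ repForms(−d)`) and `h(−d) = classNumber(−d)`:
`Σ_{1 ≤ n ≤ ⌊√d⌋/2} Σ_i #reps(q_i, n) ≤ 2 h(−d) ≤ Σ_{1 ≤ n ≤ ⌊√(d/3)⌋} Σ_i #reps(q_i, n)`. Proof as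
printed: a reduced class `(a, b, c)` has `a ≤ √(d/3)` and `c > √d/2` («On a 3a² ≤ 4ac − b² < 4c²
(l'inégalité est stricte car d ≠ 4), d'où a ≤ √(d/3) et c > √d/2»); it represents `a` by `(±1, 0)`,
and below `c` nothing else. [cite: Oesterle1988Gauss, II §1 (15) p. 54] -/
theorem encadrement_classNumber {d : ℕ} (hd4 : 4 < d)
    (hfd : ((-(d : ℤ)) % 4 = 1 ∧ Squarefree (-(d : ℤ)) ∧ (-(d : ℤ)) ≠ 1) ∨
      (4 ∣ (-(d : ℤ)) ∧ ((-(d : ℤ)) / 4 % 4 = 2 ∨ (-(d : ℤ)) / 4 % 4 = 3) ∧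
        Squarefree ((-(d : ℤ)) / 4))) :
    ∑ n ∈ Icc 1 (Nat.sqrt d / 2), ∑ R ∈ repForms (-(d : ℤ)), (reps R n).card
        ≤ 2 * classNumber (-(d : ℤ)) ∧
      2 * classNumber (-(d : ℤ)) ≤
        ∑ n ∈ Icc 1 (Nat.sqrt (d / 3)), ∑ R ∈ repForms (-(d : ℤ)), (reps R n).card := by
  have hd0 : 0 < d := by omega
  rw [← card_repForms_eq_classNumber hfd hd0, Finset.card_eq_sum_ones, Finset.mul_sum,
    Finset.sum_comm (s := Icc 1 (Nat.sqrt d / 2)), Finset.sum_comm (s := Icc 1 (Nat.sqrt (d / 3)))]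
  simp only [mul_one]
  -- facts about one reduced class
  have hsq : ((Nat.sqrt d : ℕ) : ℤ) ^ 2 ≤ (d : ℤ) := by exact_mod_cast Nat.sqrt_le' d
  have hcls : ∀ R ∈ repForms (-(d : ℤ)), R.IsReduced ∧ 0 < R.a ∧ R.disc < 0 ∧
      ((Nat.sqrt d / 2 : ℕ) : ℤ) < R.c ∧ R.a.toNat ∈ Icc 1 (Nat.sqrt (d / 3)) ∧
      ({((1 : ℤ), (0 : ℤ)), (-1, 0)} : Finset (ℤ × ℤ)) ⊆ reps R R.a.toNat := by
    intro R hR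
    obtain ⟨hpp, hred⟩ := isPosPrim_and_isReduced_of_mem_repForms hfd hd0 hR
    have ha := hpp.a_pos
    have hdisc : R.disc = -(d : ℤ) := hpp.disc_eq
    have hD : R.disc < 0 := by rw [hdisc]; omega
    have hba : |R.b| ≤ R.a := hred.1
    have hac : R.a ≤ R.c := hred.2.1
    have hbsq : R.b ^ 2 ≤ R.a ^ 2 := by nlinarith [abs_nonneg R.b, sq_abs R.b]
    have hdeq : R.b ^ 2 - 4 * R.a * R.c = -(d : ℤ) := by rw [← hdisc]; rfl
    -- `3a² ≤ d` and `4c² > d`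
    have h3a : 3 * R.a ^ 2 ≤ (d : ℤ) := by nlinarith
    have h4c : (d : ℤ) < 4 * R.c ^ 2 := by
      rcases lt_or_eq_of_le hac with hlt | heq
      · nlinarith
      · -- `a = c`: then `b ≠ 0`, for `(a, 0, a)` primitive has `d = 4`
        have hb0 : R.b ≠ 0 := by
          intro hb
          have ha1 : R.a = 1 := by
            have hu := (isPrimitive_iff R).mp hpp.primitive R.a dvd_rfl (by rw [hb]; exact dvd_zero _)
              (heq ▸ dvd_rfl)
            rcases Int.isUnit_iff.mp hu with h | h
            · exact h
            · linarith
          rw [hb, ← heq, ha1] at hdeq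
          norm_num at hdeq
          omega
        have : 0 < R.b ^ 2 := by positivity
        nlinarith
    refine ⟨hred, ha, hD, ?_, ?_, ?_⟩
    · -- `⌊√d⌋/2 < c`
      have h2c : ((Nat.sqrt d : ℕ) : ℤ) < 2 * R.c := by
        by_contra h
        push Not at h
        have hc0 : 0 ≤ R.c := by linarith
        nlinarith
      have : ((Nat.sqrt d / 2 : ℕ) : ℤ) * 2 ≤ ((Nat.sqrt d : ℕ) : ℤ) := by
        exact_mod_cast Nat.div_mul_le_self (Nat.sqrt d) 2
      linarith
    · -- `1 ≤ a ≤ ⌊√(d/3)⌋`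
      rw [mem_Icc]
      have haN : (R.a.toNat : ℤ) = R.a := Int.toNat_of_nonneg ha.le
      constructor
      · omega
      · refine Nat.le_sqrt.mpr ((Nat.le_div_iff_mul_le (by norm_num)).mpr ?_)
        have : (R.a.toNat : ℤ) * R.a.toNat * 3 ≤ d := by rw [haN]; nlinarith
        exact_mod_cast this
    · -- `(±1, 0)` properly represent `a`
      intro v hv
      rw [mem_insert, mem_singleton] at hv
      rw [mem_reps ha hD]
      have haN : (R.a.toNat : ℤ) = R.a := Int.toNat_of_nonneg ha.le
      rcases hv with rfl | rfl
      · exact ⟨by simp only [eval]; rw [haN]; ring, by simp⟩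
      · exact ⟨by simp only [eval]; rw [haN]; ring, by simp⟩
  constructor
  · -- lower half: each class contributes at most `#{(±1, 0)} = 2` below `c`
    refine Finset.sum_le_sum fun R hR => ?_
    obtain ⟨hred, ha, hD, hc, -, -⟩ := hcls R hR
    have hdisj : ∀ x ∈ Icc 1 (Nat.sqrt d / 2), ∀ y ∈ Icc 1 (Nat.sqrt d / 2), x ≠ y →
        Disjoint (reps R x) (reps R y) := by
      intro x _ y _ hxy
      rw [Finset.disjoint_left]
      intro v hvx hvy
      rw [mem_reps ha hD] at hvx hvy
      have : (x : ℤ) = y := hvx.1.symm.trans hvy.1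
      exact hxy (by exact_mod_cast this)
    rw [← Finset.card_biUnion hdisj]
    have hsub : (Icc 1 (Nat.sqrt d / 2)).biUnion (fun n => reps R n) ⊆ {((1 : ℤ), (0 : ℤ)), (-1, 0)} := by
      intro v hv
      rw [Finset.mem_biUnion] at hv
      obtain ⟨n, hn, hvn⟩ := hv
      rw [mem_Icc] at hn
      have hnc : (n : ℤ) < R.c := lt_of_le_of_lt (by exact_mod_cast hn.2) hc
      exact reps_subset_of_lt_c hred ha hD hnc hvn
    exact (Finset.card_le_card hsub).trans (by simp)
  · -- upper half: each class represents its `a ≤ √(d/3)` by `(±1, 0)`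
    refine Finset.sum_le_sum fun R hR => ?_
    obtain ⟨-, -, -, -, hmem, hsub⟩ := hcls R hR
    refine le_trans ?_ (Finset.single_le_sum (fun n _ => Nat.zero_le _) hmem)
    exact le_trans (by simp) (Finset.card_le_card hsub)


/-! ## The COROLLAIRE: `r_n(−d) ≠ 0 ⟺ n = d′p₁^{α₁}⋯p_m^{α_m}`, and then `r_n(−d) = 2^m`

Oesterlé, p. 54: «En décomposant Z/4nZ en ses composantes primaires, on obtient la forme équivalente
suivante de l'énoncé précédent: COROLLAIRE. Pour que r_n(−d) ≠ 0, il faut et il suffit que n soit de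
la forme d′p₁^{α₁} … p_m^{α_m}, avec d′ un diviseur de d sans facteurs carrés, p₁, …, p_m des nombres
premiers deux à deux distincts modulo lesquels −d est un carré non nul, et α₁, …, α_m des entiers
≥ 1. On a alors r_n(−d) = 2^m.» With `b = 2M + β` (`−d = β² − 4e`, `β ∈ {0, 1}`, as in the proof of
the Théorème) the `b (mod 2n)` with `b² ≡ −d (mod 4n)` are the roots `M (mod n)` of
`M² + βM + e ≡ 0 (mod n)` (`card_sqrtsMod_eq_card_qroots`), whose number is multiplicative in `n`
and is computed prime power by prime power below. «premiers modulo lesquels −d est un carré non nul»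
= the primes of `𝒫_{−d} = kroneckerOnePrimes (−d)` (Kronecker symbol `(−d/p) = 1`; at `p = 2`:
`−d ≡ 1 (mod 8)`). -/

open Literature.NumberTheory.QuadraticFields.BinaryQuadraticForm (kroneckerOnePrimes
  mem_kroneckerOnePrimes prime_of_mem_kroneckerOnePrimes not_dvd_of_mem_kroneckerOnePrimes
  two_mem_kroneckerOnePrimes_iff mem_kroneckerOnePrimes_iff_of_ne_two)

section Corollaire

variable {b e : ℤ}

/-! ### The number of roots of `M² + bM + e ≡ 0 (mod E)` is multiplicative in `E` -/

/-- Restricting a root modulo `n` to a root modulo a divisor `q` of `n`. [folklore] -/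
private theorem mod_mem_qroots_of_dvd {n q M : ℕ} (hq : 0 < q) (hqn : q ∣ n) (hM : M ∈ qroots b e n) :
    M % q ∈ qroots b e q := by
  rw [mem_qroots] at hM ⊢
  refine ⟨Nat.mod_lt _ hq, ?_⟩
  have h1 : (q : ℤ) ∣ (M : ℤ) ^ 2 + b * M + e := (Int.natCast_dvd_natCast.mpr hqn).trans hM.2
  have hmod : (M : ℤ) ≡ ((M % q : ℕ) : ℤ) [ZMOD (q : ℤ)] := by
    rw [Int.natCast_mod]; exact (Int.mod_modEq _ _).symm
  exact dvd_quad_of_modEq hmod h1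

/-- **Chinese remainder theorem for the roots of `M² + bM + e`**: for coprime moduli `m`, `n` the
roots modulo `mn` correspond to pairs of roots modulo `m` and modulo `n`, so their number is
multiplicative — the step «En décomposant Z/4nZ en ses composantes primaires» of Oesterlé's proof of
the Corollaire. [cite: Oesterle1988Gauss, II §1 p. 54 (proof of the Corollaire)] -/
theorem card_qroots_mul {m n : ℕ} (hmn : m.Coprime n) (hm : 0 < m) (hn : 0 < n) :
    (qroots b e (m * n)).card = (qroots b e m).card * (qroots b e n).card := by
  rw [← card_product]
  refine card_bij' (fun M _ => (M % m, M % n))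
    (fun xy _ => (Nat.chineseRemainder hmn xy.1 xy.2 : ℕ)) ?_ ?_ ?_ ?_
  · intro M hM
    rw [mem_product]
    exact ⟨mod_mem_qroots_of_dvd hm (dvd_mul_right m n) hM,
      mod_mem_qroots_of_dvd hn (dvd_mul_left n m) hM⟩
  · rintro ⟨x, y⟩ hxy
    rw [mem_product] at hxy
    obtain ⟨hx, hy⟩ := hxy
    rw [mem_qroots] at hx hy ⊢
    set k := Nat.chineseRemainder hmn x y with hk
    refine ⟨Nat.chineseRemainder_lt_mul hmn x y hm.ne' hn.ne', ?_⟩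
    have h1 : (m : ℤ) ∣ ((k : ℕ) : ℤ) ^ 2 + b * (k : ℕ) + e :=
      dvd_quad_of_modEq (Int.natCast_modEq_iff.mpr k.prop.1).symm hx.2
    have h2 : (n : ℤ) ∣ ((k : ℕ) : ℤ) ^ 2 + b * (k : ℕ) + e :=
      dvd_quad_of_modEq (Int.natCast_modEq_iff.mpr k.prop.2).symm hy.2
    push_cast
    exact (Nat.isCoprime_iff_coprime.mpr hmn).mul_dvd h1 h2
  · intro M hM
    rw [mem_qroots] at hM
    have h := Nat.chineseRemainder_modEq_unique hmn (Nat.mod_modEq M m).symm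
      (Nat.mod_modEq M n).symm
    exact (Nat.ModEq.eq_of_lt_of_lt h hM.1
      (Nat.chineseRemainder_lt_mul hmn _ _ hm.ne' hn.ne')).symm
  · rintro ⟨x, y⟩ hxy
    rw [mem_product, mem_qroots, mem_qroots] at hxy
    obtain ⟨⟨hx, -⟩, ⟨hy, -⟩⟩ := hxy
    have h1 : ((Nat.chineseRemainder hmn x y : ℕ)) % m = x := by
      have := (Nat.chineseRemainder hmn x y).prop.1
      unfold Nat.ModEq at this
      rw [this, Nat.mod_eq_of_lt hx]
    have h2 : ((Nat.chineseRemainder hmn x y : ℕ)) % n = y := by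
      have := (Nat.chineseRemainder hmn x y).prop.2
      unfold Nat.ModEq at this
      rw [this, Nat.mod_eq_of_lt hy]
    exact Prod.ext h1 h2

/-- The modulus `1`: `qroots b e 1 = {0}`. [folklore] -/
private theorem qroots_one : qroots b e 1 = {0} := by
  ext M
  rw [mem_qroots, mem_singleton]
  constructor
  · rintro ⟨hM, -⟩; omega
  · rintro rfl; exact ⟨Nat.one_pos, by simp⟩

/-! ### Local counts at a prime power `p^k` (`D = b² − 4e`) -/

/-- **Split primes, at most two roots.** If `p ∤ D = b² − 4e` and `M² + bM + e ≡ 0 (mod p^k)` has a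
root `M₀` (`k ≥ 1`), then its roots are exactly `M₀` and `−b − M₀ (mod p^k)`, which are distinct:
for two roots `M, M₀` one has `p^k ∣ (M − M₀)(M + M₀ + b)` and `p` cannot divide both factors
(their difference `2M₀ + b` satisfies `(2M₀ + b)² ≡ D (mod p)`) — the `p`-primary component at a
prime «modulo lequel D est un carré non nul» in Oesterlé's Corollaire.
[cite: Oesterle1988Gauss, II §1 Corollaire p. 54 (p-primary component, p split)] -/
theorem card_qroots_prime_pow_eq_two {p k : ℕ} (hp : p.Prime) (hk : 0 < k)
    (hD : ¬ (p : ℤ) ∣ b ^ 2 - 4 * e) {M₀ : ℕ} (hM₀ : M₀ ∈ qroots b e (p ^ k)) :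
    (qroots b e (p ^ k)).card = 2 := by
  have hq0 : (0 : ℤ) < ((p ^ k : ℕ) : ℤ) := by
    have := hp.pos
    positivity
  have hpint : Prime (p : ℤ) := Nat.prime_iff_prime_int.mp hp
  have hpq : (p : ℤ) ∣ ((p ^ k : ℕ) : ℤ) := by push_cast; exact dvd_pow_self _ hk.ne'
  rw [mem_qroots] at hM₀
  obtain ⟨hM₀q, hM₀dvd⟩ := hM₀
  -- the second root `M₁ ≡ −b − M₀ (mod p^k)`
  set M₁ : ℕ := ((-b - M₀) % ((p ^ k : ℕ) : ℤ)).toNat with hM₁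
  have hM₁cast : (M₁ : ℤ) = (-b - M₀) % ((p ^ k : ℕ) : ℤ) :=
    Int.toNat_of_nonneg (Int.emod_nonneg _ hq0.ne')
  have hM₁lt : M₁ < p ^ k := by
    have := Int.emod_lt_of_pos (-b - M₀) hq0
    omega
  have hM₁mod : (-b - (M₀ : ℤ)) ≡ (M₁ : ℤ) [ZMOD ((p ^ k : ℕ) : ℤ)] := by
    rw [hM₁cast]; exact (Int.mod_modEq _ _).symm
  have hM₁dvd : ((p ^ k : ℕ) : ℤ) ∣ (M₁ : ℤ) ^ 2 + b * M₁ + e := by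
    refine dvd_quad_of_modEq hM₁mod ?_
    have : (-b - (M₀ : ℤ)) ^ 2 + b * (-b - M₀) + e = (M₀ : ℤ) ^ 2 + b * M₀ + e := by ring
    rw [this]; exact hM₀dvd
  -- key: `p ∤ 2M₀ + b`
  have hkey : ¬ (p : ℤ) ∣ 2 * M₀ + b := by
    intro h
    apply hD
    have h1 : (p : ℤ) ∣ (2 * M₀ + b) ^ 2 := dvd_pow h two_ne_zero
    have h2 : (p : ℤ) ∣ (M₀ : ℤ) ^ 2 + b * M₀ + e := hpq.trans hM₀dvd
    have : b ^ 2 - 4 * e = (2 * M₀ + b) ^ 2 - 4 * ((M₀ : ℤ) ^ 2 + b * M₀ + e) := by ring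
    rw [this]
    exact dvd_sub h1 (dvd_mul_of_dvd_right h2 4)
  -- every root is `M₀` or `M₁`
  have hsub : qroots b e (p ^ k) ⊆ {M₀, M₁} := by
    intro M hM
    rw [mem_qroots] at hM
    obtain ⟨hMq, hMdvd⟩ := hM
    rw [mem_insert, mem_singleton]
    have hprod : ((p ^ k : ℕ) : ℤ) ∣ ((M : ℤ) - M₀) * ((M : ℤ) + M₀ + b) := by
      have : ((M : ℤ) - M₀) * ((M : ℤ) + M₀ + b) =
          ((M : ℤ) ^ 2 + b * M + e) - ((M₀ : ℤ) ^ 2 + b * M₀ + e) := by ring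
      rw [this]; exact dvd_sub hMdvd hM₀dvd
    push_cast at hprod
    by_cases h1 : (p : ℤ) ∣ (M : ℤ) - M₀
    · -- then `p ∤ M + M₀ + b`, so `p^k ∣ M − M₀`
      have h2 : ¬ (p : ℤ) ∣ (M : ℤ) + M₀ + b := by
        intro h2
        apply hkey
        have : (2 * (M₀ : ℤ) + b) = ((M : ℤ) + M₀ + b) - ((M : ℤ) - M₀) := by ring
        rw [this]; exact dvd_sub h2 h1
      have hcop : IsCoprime ((p : ℤ) ^ k) ((M : ℤ) + M₀ + b) :=
        ((Prime.coprime_iff_not_dvd hpint).mpr h2).pow_left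
      have hdvd : ((p ^ k : ℕ) : ℤ) ∣ (M : ℤ) - M₀ := by
        push_cast; exact hcop.dvd_of_dvd_mul_right hprod
      left
      exact ((Nat.modEq_iff_dvd.mpr hdvd).eq_of_lt_of_lt hM₀q hMq).symm
    · -- `p ∤ M − M₀`, so `p^k ∣ M + M₀ + b`
      have hcop : IsCoprime ((p : ℤ) ^ k) ((M : ℤ) - M₀) :=
        ((Prime.coprime_iff_not_dvd hpint).mpr h1).pow_left
      have hdvd : ((p ^ k : ℕ) : ℤ) ∣ (M : ℤ) + M₀ + b := by
        push_cast; exact hcop.dvd_of_dvd_mul_left hprod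
      right
      have hmod : (M : ℤ) ≡ (M₁ : ℤ) [ZMOD ((p ^ k : ℕ) : ℤ)] := by
        refine Int.ModEq.trans ?_ hM₁mod
        rw [Int.modEq_iff_dvd]
        have : -b - (M₀ : ℤ) - M = -((M : ℤ) + M₀ + b) := by ring
        rw [this]; exact (dvd_neg).mpr hdvd
      exact (Int.natCast_modEq_iff.mp hmod).eq_of_lt_of_lt hMq hM₁lt
  -- `M₀ ≠ M₁`
  have hne : M₀ ≠ M₁ := by
    intro h
    apply hkey
    have hmod : (M₀ : ℤ) ≡ -b - M₀ [ZMOD ((p ^ k : ℕ) : ℤ)] := by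
      rw [h]; exact h ▸ hM₁mod.symm
    have hdvd := (Int.modEq_iff_dvd.mp hmod)
    have : -b - (M₀ : ℤ) - M₀ = -(2 * M₀ + b) := by ring
    rw [this, dvd_neg] at hdvd
    exact hpq.trans hdvd
  have hsup : ({M₀, M₁} : Finset ℕ) ⊆ qroots b e (p ^ k) := by
    intro M hM
    rw [mem_insert, mem_singleton] at hM
    rcases hM with rfl | rfl
    · exact mem_qroots.mpr ⟨hM₀q, hM₀dvd⟩
    · exact mem_qroots.mpr ⟨hM₁lt, hM₁dvd⟩
  rw [Subset.antisymm hsub hsup, card_pair hne]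

/-- `b² − 4e ≡ 0` or `1 (mod 4)`. [folklore] -/
private theorem sq_sub_four_mul_emod_four (b e : ℤ) : (b ^ 2 - 4 * e) % 4 = 0 ∨ (b ^ 2 - 4 * e) % 4 = 1 := by
  rcases Int.even_or_odd b with ⟨t, ht⟩ | ⟨t, ht⟩
  · left; rw [ht]; ring_nf; omega
  · right; rw [ht]; ring_nf; omega

/-- **Split primes, existence.** If `p ∈ 𝒫_D` (`D = b² − 4e`; i.e. `p ∤ D` and `D` is a square
modulo `4p`), then `M² + bM + e ≡ 0 (mod p^k)` has a root for every `k ≥ 1` (Hensel: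
`exists_sq_sub_dvd_prime_pow` for odd `p`, `exists_sq_sub_dvd_two_pow` for `p = 2`, then
`2M + b ≡ y`). [cite: Oesterle1988Gauss, II §1 Corollaire p. 54 (p-primary component, p split)] -/
theorem qroots_prime_pow_nonempty {p k : ℕ} (hk : 0 < k)
    (hp : p ∈ kroneckerOnePrimes (b ^ 2 - 4 * e)) : (qroots b e (p ^ k)).Nonempty := by
  set D := b ^ 2 - 4 * e with hDdef
  have hpp : p.Prime := prime_of_mem_kroneckerOnePrimes hp
  have hq0 : (0 : ℤ) < (p : ℤ) ^ k := by
    have : (0 : ℤ) < p := by exact_mod_cast hpp.pos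
    positivity
  -- an integer root `M'`
  obtain ⟨M', hM'⟩ : ∃ M' : ℤ, (p : ℤ) ^ k ∣ M' ^ 2 + b * M' + e := by
    by_cases hp2 : p = 2
    · subst hp2
      have h8 : D % 8 = 1 := two_mem_kroneckerOnePrimes_iff.mp hp
      obtain ⟨y, hy⟩ := exists_sq_sub_dvd_two_pow h8 (k := k + 2) (by omega)
      -- `b` and `y` are odd
      obtain ⟨s, hs⟩ : Odd b := by
        rcases Int.even_or_odd b with ⟨t, ht⟩ | hb
        · exfalso; rw [hDdef, ht] at h8; ring_nf at h8; omega
        · exact hb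
      obtain ⟨t, ht⟩ : Odd y := by
        rcases Int.even_or_odd y with ⟨t, ht⟩ | hy'
        · exfalso
          have h4 : (4 : ℤ) ∣ y ^ 2 - D :=
            dvd_trans (show (4 : ℤ) ∣ (2 : ℤ) ^ (k + 2) from ⟨2 ^ k, by ring⟩) hy
          rw [ht] at h4
          obtain ⟨c, hc⟩ := h4
          have : (t + t) ^ 2 = 4 * (t * t) := by ring
          omega
        · exact hy'
      refine ⟨t - s, ?_⟩
      have hcalc : 4 * ((t - s) ^ 2 + b * (t - s) + e) = y ^ 2 - D := by
        rw [hDdef, ht, hs]; ring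
      have key : (2 : ℤ) ^ (k + 2) = 4 * 2 ^ k := by ring
      rw [key, ← hcalc] at hy
      have := (mul_dvd_mul_iff_left (by norm_num : (4 : ℤ) ≠ 0)).mp hy
      push_cast
      exact this
    · -- odd `p`
      obtain ⟨hpD, x, hx⟩ := (mem_kroneckerOnePrimes_iff_of_ne_two (sq_sub_four_mul_emod_four b e) hpp hp2).mp hp
      obtain ⟨y, hy, -⟩ := exists_sq_sub_dvd_prime_pow hpp hp2 hpD hx (Nat.one_le_iff_ne_zero.mpr hk.ne')
      -- `2` is invertible modulo `p^k`
      have hcop : IsCoprime (2 : ℤ) ((p : ℤ) ^ k) := by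
        have : IsCoprime (2 : ℤ) (p : ℤ) := by
          rw [Prime.coprime_iff_not_dvd Int.prime_two]
          intro h
          have h' : (2 : ℕ) ∣ p := by exact_mod_cast h
          exact hp2 ((Nat.prime_dvd_prime_iff_eq Nat.prime_two hpp).mp h').symm
        exact this.pow_right
      obtain ⟨u, v, huv⟩ := hcop
      refine ⟨u * (y - b), ?_⟩
      have h2M : 2 * (u * (y - b)) + b = y - v * (p : ℤ) ^ k * (y - b) := by
        linear_combination (y - b) * huv
      have h4f : 4 * ((u * (y - b)) ^ 2 + b * (u * (y - b)) + e) =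
          (2 * (u * (y - b)) + b) ^ 2 - D := by rw [hDdef]; ring
      have hdvd4 : (p : ℤ) ^ k ∣ 4 * ((u * (y - b)) ^ 2 + b * (u * (y - b)) + e) := by
        rw [h4f, h2M]
        have : (y - v * (p : ℤ) ^ k * (y - b)) ^ 2 - D =
            (p : ℤ) ^ k * (v * (y - b) * (v * (p : ℤ) ^ k * (y - b) - 2 * y)) + (y ^ 2 - D) := by ring
        rw [this]
        exact dvd_add (dvd_mul_right _ _) hy
      have hcop4 : IsCoprime ((p : ℤ) ^ k) 4 := by
        have h4 : (4 : ℤ) = 2 ^ 2 := by norm_num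
        rw [h4]
        exact (IsCoprime.symm ⟨u, v, huv⟩).pow_right
      exact hcop4.dvd_of_dvd_mul_left hdvd4
  -- reduce `M'` into `[0, p^k)`
  refine ⟨(M' % (p : ℤ) ^ k).toNat, mem_qroots.mpr ⟨?_, ?_⟩⟩
  · have h1 := Int.emod_lt_of_pos M' hq0
    have h2 := Int.emod_nonneg M' hq0.ne'
    have : (((M' % (p : ℤ) ^ k).toNat : ℕ) : ℤ) < ((p ^ k : ℕ) : ℤ) := by
      push_cast; rw [Int.toNat_of_nonneg h2]; exact h1
    exact_mod_cast this
  · push_cast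
    rw [Int.toNat_of_nonneg (Int.emod_nonneg M' hq0.ne')]
    exact dvd_quad_of_modEq (Int.mod_modEq _ _).symm hM'

/-- **Inert primes.** If `p ∤ D` and `p ∉ 𝒫_D` then `M² + bM + e` has no root modulo `p^k`
(`k ≥ 1`): a root `M` would give `(2M + b)² ≡ D (mod 4p)`.
[cite: Oesterle1988Gauss, II §1 Corollaire p. 54 (p-primary component, p inert)] -/
theorem qroots_prime_pow_eq_empty_of_not_mem {p k : ℕ} (hp : p.Prime) (hk : 0 < k)
    (hpD : ¬ (p : ℤ) ∣ b ^ 2 - 4 * e) (hP : p ∉ kroneckerOnePrimes (b ^ 2 - 4 * e)) :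
    qroots b e (p ^ k) = ∅ := by
  rw [eq_empty_iff_forall_notMem]
  intro M hM
  rw [mem_qroots] at hM
  obtain ⟨-, hdvd⟩ := hM
  push_cast at hdvd
  apply hP
  refine mem_kroneckerOnePrimes.mpr ⟨hp, hpD, 2 * M + b, ?_⟩
  have h4f : (2 * (M : ℤ) + b) ^ 2 - (b ^ 2 - 4 * e) = 4 * ((M : ℤ) ^ 2 + b * M + e) := by ring
  rw [h4f]
  exact mul_dvd_mul_left 4 ((dvd_pow_self (p : ℤ) hk.ne').trans hdvd)

/-- **Ramified primes, one root modulo `p`.** If `p ∣ D = b² − 4e` then `M² + bM + e` has exactly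
one root modulo `p` (odd `p`: `p ∣ M² + bM + e ⟺ p ∣ 2M + b`; `p = 2`: `b` is even and
`M² + bM + e ≡ M + e (mod 2)`) — the factor `d′` «diviseur de d sans facteurs carrés» of the
Corollaire. [cite: Oesterle1988Gauss, II §1 Corollaire p. 54 (p-primary component, p ∣ d)] -/
theorem card_qroots_prime_eq_one {p : ℕ} (hp : p.Prime) (hD : (p : ℤ) ∣ b ^ 2 - 4 * e) :
    (qroots b e p).card = 1 := by
  rw [card_eq_one]
  by_cases hp2 : p = 2
  · subst hp2
    obtain ⟨s, hs⟩ : Even b := by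
      rcases Int.even_or_odd b with hb | ⟨t, ht⟩
      · exact hb
      · exfalso; rw [ht] at hD; obtain ⟨c, hc⟩ := hD; ring_nf at hc; omega
    rcases Int.emod_two_eq_zero_or_one e with he | he
    · refine ⟨0, ?_⟩
      ext M
      rw [mem_qroots, mem_singleton]
      constructor
      · rintro ⟨hM, hdvd⟩
        interval_cases M
        · rfl
        · exfalso; push_cast at hdvd; rw [hs] at hdvd; obtain ⟨c, hc⟩ := hdvd; omega
      · rintro rfl
        refine ⟨by norm_num, ?_⟩
        push_cast
        exact ⟨e / 2, by omega⟩
    · refine ⟨1, ?_⟩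
      ext M
      rw [mem_qroots, mem_singleton]
      constructor
      · rintro ⟨hM, hdvd⟩
        interval_cases M
        · exfalso; push_cast at hdvd; obtain ⟨c, hc⟩ := hdvd; omega
        · rfl
      · rintro rfl
        refine ⟨by norm_num, ?_⟩
        push_cast
        rw [hs]
        exact ⟨s + (e + 1) / 2, by omega⟩
  · -- odd `p`
    have hpint : Prime (p : ℤ) := Nat.prime_iff_prime_int.mp hp
    have hcop : IsCoprime (2 : ℤ) (p : ℤ) := by
      rw [Prime.coprime_iff_not_dvd Int.prime_two]
      intro h
      have h' : (2 : ℕ) ∣ p := by exact_mod_cast h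
      exact hp2 ((Nat.prime_dvd_prime_iff_eq Nat.prime_two hp).mp h').symm
    have hcop4 : IsCoprime (p : ℤ) 4 := by
      have h4 : (4 : ℤ) = 2 ^ 2 := by norm_num
      rw [h4]; exact hcop.symm.pow_right
    have hiff : ∀ M : ℤ, (p : ℤ) ∣ M ^ 2 + b * M + e ↔ (p : ℤ) ∣ 2 * M + b := by
      intro M
      have h4f : 4 * (M ^ 2 + b * M + e) + (b ^ 2 - 4 * e) = (2 * M + b) ^ 2 := by ring
      constructor
      · intro h
        have : (p : ℤ) ∣ (2 * M + b) ^ 2 := by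
          rw [← h4f]; exact dvd_add (dvd_mul_of_dvd_right h 4) hD
        exact hpint.dvd_of_dvd_pow this
      · intro h
        have : (p : ℤ) ∣ 4 * (M ^ 2 + b * M + e) := by
          have h' : 4 * (M ^ 2 + b * M + e) = (2 * M + b) ^ 2 - (b ^ 2 - 4 * e) := by rw [← h4f]; ring
          rw [h']; exact dvd_sub (dvd_pow h two_ne_zero) hD
        exact hcop4.dvd_of_dvd_mul_left this
    -- the root `M* ≡ −b/2 (mod p)`
    obtain ⟨u, v, huv⟩ := hcop
    have hp0 : (0 : ℤ) < p := by exact_mod_cast hp.pos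
    set Ms : ℕ := ((-(u * b)) % (p : ℤ)).toNat with hMs
    have hMscast : (Ms : ℤ) = (-(u * b)) % (p : ℤ) := Int.toNat_of_nonneg (Int.emod_nonneg _ hp0.ne')
    have hMslt : Ms < p := by
      have := Int.emod_lt_of_pos (-(u * b)) hp0
      omega
    have hMsmod : (Ms : ℤ) ≡ -(u * b) [ZMOD (p : ℤ)] := by rw [hMscast]; exact Int.mod_modEq _ _
    have hroot : (p : ℤ) ∣ 2 * (-(u * b)) + b := by
      have : 2 * (-(u * b)) + b = p * (v * b) := by linear_combination (-b) * huv
      rw [this]; exact dvd_mul_right _ _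
    refine ⟨Ms, ?_⟩
    ext M
    rw [mem_qroots, mem_singleton]
    constructor
    · rintro ⟨hM, hdvd⟩
      have h1 : (p : ℤ) ∣ 2 * (M : ℤ) + b := (hiff M).mp hdvd
      -- `p ∣ 2 (M − M*)`, so `M ≡ M* (mod p)`
      have h2 : (p : ℤ) ∣ 2 * ((M : ℤ) - (-(u * b))) := by
        have : 2 * ((M : ℤ) - (-(u * b))) = (2 * (M : ℤ) + b) - (2 * (-(u * b)) + b) := by ring
        rw [this]; exact dvd_sub h1 hroot
      have h3 : (p : ℤ) ∣ (M : ℤ) - (-(u * b)) := (IsCoprime.symm ⟨u, v, huv⟩).dvd_of_dvd_mul_left h2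
      have hmod : (M : ℤ) ≡ (Ms : ℤ) [ZMOD (p : ℤ)] :=
        ((Int.modEq_iff_dvd.mpr (by rwa [dvd_sub_comm] )).trans hMsmod.symm)
      exact (Int.natCast_modEq_iff.mp hmod).eq_of_lt_of_lt hM hMslt
    · rintro rfl
      refine ⟨hMslt, (hiff Ms).mpr ?_⟩
      have : 2 * (Ms : ℤ) + b = 2 * ((Ms : ℤ) - (-(u * b))) + (2 * (-(u * b)) + b) := by ring
      rw [this]
      exact dvd_add (dvd_mul_of_dvd_right (Int.modEq_iff_dvd.mp hMsmod.symm) 2) hroot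

/-- **Ramified primes, no root modulo `p²`** when `D = b² − 4e` is a fundamental discriminant at
`p` (`p² ∤ D` for odd `p`; `D ≡ 8, 12 (mod 16)` if `p = 2 ∣ D`): for odd `p`,
`p² ∣ (2M + b)² − D` and `p ∣ D` force `p² ∣ D`; for `p = 2`, `(M + b/2)² ≡ D/4 ≡ 2, 3 (mod 4)` is
impossible. Hence no root modulo `p^k`, `k ≥ 2` («sans facteurs carrés»).
[cite: Oesterle1988Gauss, II §1 Corollaire p. 54 (p-primary component, p ∣ d, exponent ≥ 2)] -/
theorem qroots_prime_pow_eq_empty_of_dvd {p k : ℕ} (hp : p.Prime) (hk : 2 ≤ k)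
    (hD : (p : ℤ) ∣ b ^ 2 - 4 * e) (hodd : p ≠ 2 → ¬ (p : ℤ) ^ 2 ∣ b ^ 2 - 4 * e)
    (htwo : p = 2 → (b ^ 2 - 4 * e) % 16 = 8 ∨ (b ^ 2 - 4 * e) % 16 = 12) :
    qroots b e (p ^ k) = ∅ := by
  rw [eq_empty_iff_forall_notMem]
  intro M hM
  have hM2 := mod_mem_qroots_of_dvd (pow_pos hp.pos 2) (pow_dvd_pow p hk) hM
  rw [mem_qroots] at hM2
  obtain ⟨-, hdvd⟩ := hM2
  have hcast : ((p ^ 2 : ℕ) : ℤ) = (p : ℤ) ^ 2 := by push_cast; ring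
  rw [hcast] at hdvd
  set N : ℤ := ((M % p ^ 2 : ℕ) : ℤ) with hN
  by_cases hp2 : p = 2
  · subst hp2
    push_cast at hD hdvd
    obtain ⟨s, hs⟩ : Even b := by
      rcases Int.even_or_odd b with hb | ⟨t, ht⟩
      · exact hb
      · exfalso; rw [ht] at hD; obtain ⟨c, hc⟩ := hD; ring_nf at hc; omega
    have h16 := htwo rfl
    rw [hs] at h16
    -- `f(N) = (N + s)² − (s² − e)` with `s² − e ≡ 2, 3 (mod 4)`
    have hf : N ^ 2 + b * N + e = (N + s) ^ 2 - (s * s - e) := by rw [hs]; ring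
    rw [hf] at hdvd
    have hss : (s + s) ^ 2 - 4 * e = 4 * (s * s - e) := by ring
    rw [hss] at h16
    obtain ⟨c, hc⟩ := hdvd
    rcases Int.even_or_odd (N + s) with ⟨t, ht⟩ | ⟨t, ht⟩
    · have : (N + s) ^ 2 = 4 * (t * t) := by rw [ht]; ring
      omega
    · have : (N + s) ^ 2 = 4 * (t * t + t) + 1 := by rw [ht]; ring
      omega
  · have hpint : Prime (p : ℤ) := Nat.prime_iff_prime_int.mp hp
    apply hodd hp2
    have h4f : (2 * N + b) ^ 2 = 4 * (N ^ 2 + b * N + e) + (b ^ 2 - 4 * e) := by ring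
    have h1 : (p : ℤ) ∣ (2 * N + b) ^ 2 := by
      rw [h4f]
      exact dvd_add (dvd_mul_of_dvd_right ((dvd_pow_self (p : ℤ) two_ne_zero).trans hdvd) 4) hD
    have h2 : (p : ℤ) ∣ 2 * N + b := hpint.dvd_of_dvd_pow h1
    have h3 : (p : ℤ) ^ 2 ∣ (2 * N + b) ^ 2 := pow_dvd_pow_of_dvd h2 2
    have : b ^ 2 - 4 * e = (2 * N + b) ^ 2 - 4 * (N ^ 2 + b * N + e) := by rw [h4f]; ring
    rw [this]
    exact dvd_sub h3 (dvd_mul_of_dvd_right hdvd 4)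


/-! ### Fundamental discriminants at a prime -/

/-- For a fundamental discriminant `D` and an odd prime `p`: `p² ∤ D`. [folklore] -/
private theorem not_sq_dvd_of_isFundamental {D : ℤ}
    (hfd : (D % 4 = 1 ∧ Squarefree D ∧ D ≠ 1) ∨
      (4 ∣ D ∧ (D / 4 % 4 = 2 ∨ D / 4 % 4 = 3) ∧ Squarefree (D / 4)))
    {p : ℕ} (hp : p.Prime) (hp2 : p ≠ 2) : ¬ (p : ℤ) ^ 2 ∣ D := by
  have hpint : Prime (p : ℤ) := Nat.prime_iff_prime_int.mp hp
  have hnu : ¬ IsUnit (p : ℤ) := hpint.not_unit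
  intro h
  rw [sq] at h
  rcases hfd with ⟨-, hsf, -⟩ | ⟨h4, -, hsf⟩
  · exact hnu (hsf _ h)
  · apply hnu
    refine hsf _ ?_
    have hD : D = 4 * (D / 4) := by rw [mul_comm, Int.ediv_mul_cancel h4]
    rw [hD] at h
    have hcop : IsCoprime ((p : ℤ) * p) 4 := by
      have hc : IsCoprime (p : ℤ) 2 := by
        rw [Prime.coprime_iff_not_dvd hpint]
        intro h2
        have h' : p ∣ 2 := by exact_mod_cast h2
        exact hp2 ((Nat.prime_dvd_prime_iff_eq hp Nat.prime_two).mp h')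
      have h4' : (4 : ℤ) = 2 ^ 2 := by norm_num
      rw [h4']
      exact (hc.mul_left hc).pow_right
    exact hcop.dvd_of_dvd_mul_left h

/-- An even fundamental discriminant is `≡ 8` or `12 (mod 16)` (`D = 4m`, `m ≡ 2, 3 (mod 4)`).
[folklore] -/
private theorem emod_sixteen_of_isFundamental {D : ℤ}
    (hfd : (D % 4 = 1 ∧ Squarefree D ∧ D ≠ 1) ∨
      (4 ∣ D ∧ (D / 4 % 4 = 2 ∨ D / 4 % 4 = 3) ∧ Squarefree (D / 4)))
    (h2 : (2 : ℤ) ∣ D) : D % 16 = 8 ∨ D % 16 = 12 := by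
  rcases hfd with ⟨h1, -, -⟩ | ⟨h4, h23, -⟩
  · exfalso; obtain ⟨c, hc⟩ := h2; omega
  · obtain ⟨c, hc⟩ := h4; subst hc; omega

/-! ### The global count -/

/-- **Ramified part**: for a squarefree `d' ∣ D`, `M² + bM + e` has exactly one root modulo `d'`
(the factor `d′` of the Corollaire contributes `2⁰`).
[cite: Oesterle1988Gauss, II §1 Corollaire p. 54] -/
theorem card_qroots_eq_one_of_squarefree {d' : ℕ} (hd' : Squarefree d')
    (hdvd : (d' : ℤ) ∣ b ^ 2 - 4 * e) : (qroots b e d').card = 1 := by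
  induction d' using Nat.recOnPosPrimePosCoprime with
  | zero => exact absurd hd' (not_squarefree_zero : ¬ Squarefree (0 : ℕ))
  | one => rw [qroots_one, card_singleton]
  | prime_pow p k hp hk =>
    have hk1 : k = 1 := ((Nat.squarefree_pow_iff hp.ne_one hk.ne').mp hd').2
    subst hk1
    rw [pow_one] at hdvd ⊢
    exact card_qroots_prime_eq_one hp (by exact_mod_cast hdvd)
  | coprime a c ha hc hac iha ihc =>
    have ha' : (a : ℤ) ∣ b ^ 2 - 4 * e :=
      dvd_trans (by push_cast; exact dvd_mul_right _ _ : (a : ℤ) ∣ ((a * c : ℕ) : ℤ)) hdvd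
    have hc' : (c : ℤ) ∣ b ^ 2 - 4 * e :=
      dvd_trans (by push_cast; exact dvd_mul_left _ _ : (c : ℤ) ∣ ((a * c : ℕ) : ℤ)) hdvd
    rw [card_qroots_mul hac (by omega) (by omega), iha hd'.of_mul_left ha',
      ihc hd'.of_mul_right hc']

/-- **Split part**: if every prime factor of `m ≥ 1` lies in `𝒫_D`, then `M² + bM + e` has exactly
`2^{ω(m)}` roots modulo `m` («On a alors r_n(−d) = 2^m», the split part).
[cite: Oesterle1988Gauss, II §1 Corollaire p. 54] -/
theorem card_qroots_eq_two_pow_of_primeFactors {m : ℕ} (hm0 : 0 < m)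
    (hm : ∀ p ∈ m.primeFactors, p ∈ kroneckerOnePrimes (b ^ 2 - 4 * e)) :
    (qroots b e m).card = 2 ^ m.primeFactors.card := by
  induction m using Nat.recOnPosPrimePosCoprime with
  | zero => exact absurd hm0 (lt_irrefl 0)
  | one => rw [qroots_one, card_singleton, Nat.primeFactors_one, card_empty, pow_zero]
  | prime_pow p k hp hk =>
    rw [Nat.primeFactors_prime_pow hk.ne' hp, card_singleton, pow_one]
    have hpP : p ∈ kroneckerOnePrimes (b ^ 2 - 4 * e) :=
      hm p (by rw [Nat.primeFactors_prime_pow hk.ne' hp]; exact mem_singleton_self p)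
    obtain ⟨M₀, hM₀⟩ := qroots_prime_pow_nonempty hk hpP
    exact card_qroots_prime_pow_eq_two hp hk (not_dvd_of_mem_kroneckerOnePrimes hpP) hM₀
  | coprime a c ha hc hac iha ihc =>
    rw [card_qroots_mul hac (by omega) (by omega), Nat.Coprime.primeFactors_mul hac,
      card_union_of_disjoint hac.disjoint_primeFactors, pow_add,
      iha (by omega) (fun p hp => hm p ?_), ihc (by omega) (fun p hp => hm p ?_)]
    · rw [Nat.Coprime.primeFactors_mul hac]; exact mem_union_right _ hp
    · rw [Nat.Coprime.primeFactors_mul hac]; exact mem_union_left _ hp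

/-- **The count**: for `d'` squarefree dividing `D = b² − 4e` and `m ≥ 1` with all prime factors in
`𝒫_D`, the congruence `M² + bM + e ≡ 0 (mod d'm)` has exactly `2^{ω(m)}` roots — the Corollaire's
«On a alors r_n(−d) = 2^m» in terms of the roots `M` (`b = 2M + β`).
[cite: Oesterle1988Gauss, II §1 Corollaire p. 54] -/
theorem card_qroots_eq_two_pow {d' m : ℕ} (hd' : Squarefree d') (hdvd : (d' : ℤ) ∣ b ^ 2 - 4 * e)
    (hm0 : 0 < m) (hm : ∀ p ∈ m.primeFactors, p ∈ kroneckerOnePrimes (b ^ 2 - 4 * e)) :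
    (qroots b e (d' * m)).card = 2 ^ m.primeFactors.card := by
  have hd'0 : 0 < d' :=
    Nat.pos_of_ne_zero (fun h => by rw [h] at hd'; exact not_squarefree_zero hd')
  have hcop : d'.Coprime m := by
    refine Nat.coprime_of_dvd fun p hp hpd hpm => ?_
    have hpP := hm p (Nat.mem_primeFactors.mpr ⟨hp, hpm, hm0.ne'⟩)
    exact not_dvd_of_mem_kroneckerOnePrimes hpP ((Int.natCast_dvd_natCast.mpr hpd).trans hdvd)
  rw [card_qroots_mul hcop hd'0 hm0, card_qroots_eq_one_of_squarefree hd' hdvd,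
    card_qroots_eq_two_pow_of_primeFactors hm0 hm, one_mul]

/-- **The support**: for a fundamental discriminant `D = b² − 4e`, if `M² + bM + e ≡ 0 (mod n)`
(`n ≥ 1`) has a root then `n = d'm` with `d'` squarefree dividing `D` and every prime factor of
`m` in `𝒫_D` (namely `d' = gcd(n, D)`) — the Corollaire's «il faut» in terms of the roots `M`.
[cite: Oesterle1988Gauss, II §1 Corollaire p. 54] -/
theorem exists_eq_mul_of_qroots_nonempty
    (hfd : ((b ^ 2 - 4 * e) % 4 = 1 ∧ Squarefree (b ^ 2 - 4 * e) ∧ (b ^ 2 - 4 * e) ≠ 1) ∨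
      (4 ∣ (b ^ 2 - 4 * e) ∧ ((b ^ 2 - 4 * e) / 4 % 4 = 2 ∨ (b ^ 2 - 4 * e) / 4 % 4 = 3) ∧
        Squarefree ((b ^ 2 - 4 * e) / 4)))
    {n : ℕ} (hn : 0 < n) (hne : (qroots b e n).Nonempty) :
    ∃ d' m : ℕ, n = d' * m ∧ Squarefree d' ∧ (d' : ℤ) ∣ b ^ 2 - 4 * e ∧ 0 < m ∧
      ∀ p ∈ m.primeFactors, p ∈ kroneckerOnePrimes (b ^ 2 - 4 * e) := by
  obtain ⟨M, hM⟩ := hne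
  set D := b ^ 2 - 4 * e with hDdef
  -- local constraints at each prime `p ∣ n`
  have hloc1 : ∀ p : ℕ, p.Prime → (p : ℤ) ∣ D → ¬ p ^ 2 ∣ n := by
    intro p hp hpD h2
    have hmem := mod_mem_qroots_of_dvd (pow_pos hp.pos 2) h2 hM
    rw [qroots_prime_pow_eq_empty_of_dvd hp le_rfl hpD
      (fun hp2 => not_sq_dvd_of_isFundamental hfd hp hp2)
      (fun hp2 => emod_sixteen_of_isFundamental hfd (by rw [hp2] at hpD; exact_mod_cast hpD))] at hmem
    exact notMem_empty _ hmem
  have hloc2 : ∀ p : ℕ, p.Prime → p ∣ n → ¬ (p : ℤ) ∣ D → p ∈ kroneckerOnePrimes D := by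
    intro p hp hpn hpD
    by_contra hP
    have hmem := mod_mem_qroots_of_dvd hp.pos hpn hM
    have h := qroots_prime_pow_eq_empty_of_not_mem hp one_pos hpD hP
    rw [pow_one] at h
    rw [h] at hmem
    exact notMem_empty _ hmem
  refine ⟨Nat.gcd n D.natAbs, n / Nat.gcd n D.natAbs, ?_, ?_, ?_, ?_, ?_⟩
  · exact (Nat.mul_div_cancel' (Nat.gcd_dvd_left _ _)).symm
  · refine Nat.squarefree_iff_prime_squarefree.mpr fun p hp h => ?_
    have hpn : p ^ 2 ∣ n := by rw [sq]; exact h.trans (Nat.gcd_dvd_left _ _)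
    have hpD : (p : ℤ) ∣ D :=
      Int.natCast_dvd.mpr (((dvd_mul_right p p).trans h).trans (Nat.gcd_dvd_right _ _))
    exact hloc1 p hp hpD hpn
  · exact Int.natCast_dvd.mpr (Nat.gcd_dvd_right _ _)
  · exact Nat.div_pos (Nat.le_of_dvd hn (Nat.gcd_dvd_left _ _)) (Nat.gcd_pos_of_pos_left _ hn)
  · intro p hp
    obtain ⟨hpp, hpm, -⟩ := Nat.mem_primeFactors.mp hp
    have hpn : p ∣ n := hpm.trans (Nat.div_dvd_of_dvd (Nat.gcd_dvd_left _ _))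
    by_cases hpD : (p : ℤ) ∣ D
    · exfalso
      have hpg : p ∣ Nat.gcd n D.natAbs := Nat.dvd_gcd hpn (Int.natCast_dvd.mp hpD)
      have hp2 : p ^ 2 ∣ n := by
        rw [sq, ← Nat.mul_div_cancel' (Nat.gcd_dvd_left n D.natAbs)]
        exact Nat.mul_dvd_mul hpg hpm
      exact hloc1 p hpp hpD hp2
    · exact hloc2 p hpp hpn hpD

/-! ### In terms of `b (mod 2n)` with `b² ≡ −d (mod 4n)` and of `r_n(−d)` -/

/-- `−d = β² − 4e` with `β ∈ {0, 1}` for `d ≡ 0, 3 (mod 4)`. [folklore] -/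
private theorem exists_beta_e {d : ℕ} (h4 : (-(d : ℤ)) % 4 = 0 ∨ (-(d : ℤ)) % 4 = 1) :
    ∃ (β : ℕ) (e : ℤ), (β = 0 ∨ β = 1) ∧ ((β : ℕ) : ℤ) ^ 2 - 4 * e = -(d : ℤ) := by
  rcases h4 with h0 | h1
  · exact ⟨0, (d : ℤ) / 4, Or.inl rfl, by push_cast; omega⟩
  · exact ⟨1, ((d : ℤ) + 1) / 4, Or.inr rfl, by push_cast; omega⟩

/-- **Oesterlé 1988, II §1, Corollaire (the count), for the `b (mod 2n)`.** Let `−d ≡ 0, 1 (mod 4)`,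
`d'` a squarefree divisor of `d`, and `m ≥ 1` an integer all of whose prime factors `p` satisfy
`(−d/p) = 1` (`p ∈ 𝒫_{−d}`). Then `#{b (mod 2n) : b² ≡ −d (mod 4n)} = 2^{ω(m)}` for `n = d'm`.
[cite: Oesterle1988Gauss, II §1 Corollaire p. 54] -/
theorem card_sqrtsMod_eq_two_pow {d : ℕ} (h4 : (-(d : ℤ)) % 4 = 0 ∨ (-(d : ℤ)) % 4 = 1)
    {d' m : ℕ} (hd' : Squarefree d') (hd'd : d' ∣ d) (hm0 : 0 < m)
    (hm : ∀ p ∈ m.primeFactors, p ∈ kroneckerOnePrimes (-(d : ℤ))) :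
    ((range (2 * (d' * m))).filter
        (fun b : ℕ => (4 * ((d' * m : ℕ) : ℤ)) ∣ (b : ℤ) ^ 2 + d)).card = 2 ^ m.primeFactors.card := by
  obtain ⟨β, e, hβ, hde⟩ := exists_beta_e h4
  rw [card_sqrtsMod_eq_card_qroots hβ hde]
  rw [← hde] at hm
  exact card_qroots_eq_two_pow hd' (by rw [hde, dvd_neg]; exact Int.natCast_dvd_natCast.mpr hd'd)
    hm0 hm

/-- **Oesterlé 1988, II §1, Corollaire (the support), for the `b (mod 2n)`.** For a negative
fundamental discriminant `−d` and `n ≥ 1`: `#{b (mod 2n) : b² ≡ −d (mod 4n)} ≠ 0` iff `n = d'm`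
with `d'` a squarefree divisor of `d` and every prime factor `p` of `m` in `𝒫_{−d}`.
[cite: Oesterle1988Gauss, II §1 Corollaire p. 54] -/
theorem card_sqrtsMod_ne_zero_iff {d : ℕ}
    (hfd : ((-(d : ℤ)) % 4 = 1 ∧ Squarefree (-(d : ℤ)) ∧ (-(d : ℤ)) ≠ 1) ∨
      (4 ∣ (-(d : ℤ)) ∧ ((-(d : ℤ)) / 4 % 4 = 2 ∨ (-(d : ℤ)) / 4 % 4 = 3) ∧
        Squarefree ((-(d : ℤ)) / 4)))
    {n : ℕ} (hn : 0 < n) :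
    ((range (2 * n)).filter (fun b : ℕ => (4 * (n : ℤ)) ∣ (b : ℤ) ^ 2 + d)).card ≠ 0 ↔
      ∃ d' m : ℕ, n = d' * m ∧ Squarefree d' ∧ d' ∣ d ∧
        ∀ p ∈ m.primeFactors, p ∈ kroneckerOnePrimes (-(d : ℤ)) := by
  have h4 : (-(d : ℤ)) % 4 = 0 ∨ (-(d : ℤ)) % 4 = 1 := by
    rcases hfd with ⟨h1, -, -⟩ | ⟨h4, -, -⟩
    · exact Or.inr h1
    · exact Or.inl (Int.emod_emod_of_dvd _ (by norm_num : (4:ℤ) ∣ 4) ▸ by omega)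
  obtain ⟨β, e, hβ, hde⟩ := exists_beta_e h4
  have hfd' := hfd
  rw [← hde] at hfd'
  rw [card_sqrtsMod_eq_card_qroots hβ hde]
  constructor
  · intro h
    obtain ⟨d', m, hnm, hsf, hdvd, -, hm⟩ :=
      exists_eq_mul_of_qroots_nonempty hfd' hn (card_ne_zero.mp h)
    refine ⟨d', m, hnm, hsf, ?_, by rw [hde] at hm; exact hm⟩
    rw [hde, dvd_neg] at hdvd
    exact Int.natCast_dvd_natCast.mp hdvd
  · rintro ⟨d', m, hnm, hsf, hdvd, hm⟩
    have hm0 : 0 < m := Nat.pos_of_ne_zero (by rintro rfl; rw [mul_zero] at hnm; omega)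
    rw [← hde] at hm
    rw [hnm, card_qroots_eq_two_pow hsf
      (by rw [hde, dvd_neg]; exact Int.natCast_dvd_natCast.mpr hdvd) hm0 hm]
    positivity

/-- **Oesterlé 1988, II §1, COROLLAIRE, as printed for `r_n(−d)` (support).** For a negative
fundamental discriminant `−d` with `d > 4` and `n ≥ 1`: `r_n(−d) ≠ 0` iff `n = d'p₁^{α₁}⋯p_m^{α_m}`
with `d'` a squarefree divisor of `d`, the `p_i` distinct primes with `(−d/p_i) = 1` and `α_i ≥ 1`
— here `2 r_n(−d) = Σ_{q_i ∈ repForms(−d)} #reps(q_i, n)`. [cite: Oesterle1988Gauss, II §1 Corollaire p. 54] -/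
theorem sum_card_reps_ne_zero_iff {d : ℕ} (hd4 : 4 < d)
    (hfd : ((-(d : ℤ)) % 4 = 1 ∧ Squarefree (-(d : ℤ)) ∧ (-(d : ℤ)) ≠ 1) ∨
      (4 ∣ (-(d : ℤ)) ∧ ((-(d : ℤ)) / 4 % 4 = 2 ∨ (-(d : ℤ)) / 4 % 4 = 3) ∧
        Squarefree ((-(d : ℤ)) / 4)))
    {n : ℕ} (hn : 0 < n) :
    (∑ R ∈ repForms (-(d : ℤ)), (reps R n).card) ≠ 0 ↔
      ∃ d' m : ℕ, n = d' * m ∧ Squarefree d' ∧ d' ∣ d ∧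
        ∀ p ∈ m.primeFactors, p ∈ kroneckerOnePrimes (-(d : ℤ)) := by
  rw [← two_mul_card_sqrtsMod_eq_sum_card_reps hd4 hfd hn, mul_ne_zero_iff,
    card_sqrtsMod_ne_zero_iff hfd hn]
  simp

/-- **Oesterlé 1988, II §1, COROLLAIRE, as printed for `r_n(−d)` (count): «On a alors
r_n(−d) = 2^m».** For a negative fundamental discriminant `−d` with `d > 4`, `d'` a squarefree
divisor of `d` and `m ≥ 1` with all prime factors in `𝒫_{−d}`:
`Σ_{q_i ∈ repForms(−d)} #reps(q_i, d'm) = 2^{ω(m) + 1}`, i.e. `r_{d'm}(−d) = 2^{ω(m)}`.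
[cite: Oesterle1988Gauss, II §1 Corollaire p. 54] -/
theorem sum_card_reps_eq_two_pow {d : ℕ} (hd4 : 4 < d)
    (hfd : ((-(d : ℤ)) % 4 = 1 ∧ Squarefree (-(d : ℤ)) ∧ (-(d : ℤ)) ≠ 1) ∨
      (4 ∣ (-(d : ℤ)) ∧ ((-(d : ℤ)) / 4 % 4 = 2 ∨ (-(d : ℤ)) / 4 % 4 = 3) ∧
        Squarefree ((-(d : ℤ)) / 4)))
    {d' m : ℕ} (hd' : Squarefree d') (hd'd : d' ∣ d) (hm0 : 0 < m)
    (hm : ∀ p ∈ m.primeFactors, p ∈ kroneckerOnePrimes (-(d : ℤ))) :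
    ∑ R ∈ repForms (-(d : ℤ)), (reps R (d' * m)).card = 2 ^ (m.primeFactors.card + 1) := by
  have hd'0 : 0 < d' :=
    Nat.pos_of_ne_zero (fun h => by rw [h] at hd'; exact not_squarefree_zero hd')
  have h4 : (-(d : ℤ)) % 4 = 0 ∨ (-(d : ℤ)) % 4 = 1 := by
    rcases hfd with ⟨h1, -, -⟩ | ⟨h4, -, -⟩
    · exact Or.inr h1
    · left; omega
  have h := two_mul_card_sqrtsMod_eq_sum_card_reps hd4 hfd (Nat.mul_pos hd'0 hm0)
  rw [card_sqrtsMod_eq_two_pow h4 hd' hd'd hm0 hm] at h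
  rw [← h, pow_succ, mul_comm]

end Corollaire

end BinQF

end Literature.NumberTheory.QuadraticFields.Quadratic
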